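import Summits.KontsevichZagierPeriods.KontsevichZagierPeriods.Theses.ZeroPortrait
import Summits.KontsevichZagierPeriods.KontsevichZagierPeriods.Theorems.UnfoldedStokesLegendreAllModuliStubSymmetrise

/-!
# `PencilValue` (stmt-KontsevichZagierPeriods-12736, route ZeroPortrait) — proof

Fubini bookkeeping for the Legendre quadratic pencil. Fix rationals `a, b, c` and `0 < s < 1`,
and write `k(t) = 1/√((1−t²)(1−st²))`, `e(t) = √(1−st²)/√(1−t²)` for the two Legendre
densities on `(0,1)`, with `K = ∫_{(0,1)} k`, `E = ∫_{(0,1)} e` (Bochner integrals). If an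
integral representation `r` has domain the open unit square `(0,1)² ⊆ ℝ²` and integrand
`a·k(x₀)k(x₁) + b·e(x₀)k(x₁) + c·e(x₀)e(x₁)` there, then `r.value = a·K² + b·E·K + c·E²`.

Proof. `r.value = ∫_{(0,1)²} r.integrand`; replace the integrand on the (measurable) square by
the explicit one, write the square as `Set.pi univ (fun _ => Ioo 0 1)` so that the restricted
Lebesgue measure is the product measure `Measure.pi (fun _ => volume|_(0,1))`
(`volume_pi`, `Measure.restrict_pi_pi`). Both densities are integrable on `(0,1)`
(`k ≤ (1−s)^{-1/2}(1−t)^{-1/2}`-type bounds, tree lemmas `integrableOn_kap`, `integrableOn_e`),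
so each tensor product `f(x₀)g(x₁)` is integrable for the product measure
(`Integrable.fintype_prod`) and has integral `(∫ f)(∫ g)` (`integral_fintype_prod_eq_prod`);
linearity of the integral finishes.

References: D. F. Lawden, *Elliptic Functions and Applications* (1989), §3.8;
M. Kontsevich, D. Zagier, *Periods* (2001), §1.1.
-/

namespace Summit.KontsevichZagierPeriods.ZeroPortrait

open MeasureTheory Set
open Literature.Probability.RandomPlanarGeometry (ellIntegrand)
open Summit.KontsevichZagierPeriods.UnfoldedStokes.LegendreAllModuliLine (M1.integrableOn_kap
  M1.integrableOn_e)

/-- **Fubini for a tensor product on `ℝ²`.** For a σ-finite measure `μ` on `ℝ` and real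
functions `f, g`, the integral of `x ↦ f(x₀) g(x₁)` over `Fin 2 → ℝ` against the product
measure `⨂ μ` is `(∫ f dμ)(∫ g dμ)` (no integrability needed). [folklore] -/
theorem pencilValue_integral_tensor (μ : Measure ℝ) [SigmaFinite μ] (f g : ℝ → ℝ) :
    ∫ x : Fin 2 → ℝ, f (x 0) * g (x 1) ∂(Measure.pi fun _ => μ) =
      (∫ t, f t ∂μ) * (∫ t, g t ∂μ) := by
  have h := integral_fintype_prod_eq_prod (𝕜 := ℝ) (ι := Fin 2) (fun i => ![f, g] i)
    (μ := fun _ => μ)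
  simp only [Fin.prod_univ_two, Matrix.cons_val_zero, Matrix.cons_val_one] at h
  exact h

/-- **Integrability of a tensor product on `ℝ²`.** For a σ-finite measure `μ` on `ℝ` and
`μ`-integrable real functions `f, g`, the function `x ↦ f(x₀) g(x₁)` on `Fin 2 → ℝ` is
integrable for the product measure `⨂ μ`. [folklore] -/
theorem pencilValue_integrable_tensor (μ : Measure ℝ) [SigmaFinite μ] {f g : ℝ → ℝ}
    (hf : Integrable f μ) (hg : Integrable g μ) :
    Integrable (fun x : Fin 2 → ℝ => f (x 0) * g (x 1)) (Measure.pi fun _ => μ) := by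
  have h := Integrable.fintype_prod (ι := Fin 2) (f := fun i => ![f, g] i) (μ := fun _ => μ)
    (fun i => by fin_cases i <;> simpa)
  simp only [Fin.prod_univ_two, Matrix.cons_val_zero, Matrix.cons_val_one] at h
  exact h

/-- **Linearity + Fubini for the pencil integrand.** For a σ-finite measure `μ` on `ℝ`,
`μ`-integrable `k, e : ℝ → ℝ` and scalars `a, b, c`,
`∫ (a·k(x₀)k(x₁) + b·e(x₀)k(x₁) + c·e(x₀)e(x₁)) d(μ⊗μ) = a·K² + b·E·K + c·E²` with `K = ∫ k dμ`,
`E = ∫ e dμ`. [folklore] -/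
theorem pencilValue_integral_pencil (μ : Measure ℝ) [SigmaFinite μ] {k e : ℝ → ℝ}
    (hk : Integrable k μ) (he : Integrable e μ) (a b c : ℝ) :
    ∫ x : Fin 2 → ℝ, (a * (k (x 0) * k (x 1)) + b * (e (x 0) * k (x 1)) +
        c * (e (x 0) * e (x 1))) ∂(Measure.pi fun _ => μ) =
      a * (∫ t, k t ∂μ) ^ 2 + b * (∫ t, e t ∂μ) * (∫ t, k t ∂μ) + c * (∫ t, e t ∂μ) ^ 2 := by
  have hA : Integrable (fun x : Fin 2 → ℝ => a * (k (x 0) * k (x 1))) (Measure.pi fun _ => μ) :=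
    (pencilValue_integrable_tensor μ hk hk).const_mul a
  have hB : Integrable (fun x : Fin 2 → ℝ => b * (e (x 0) * k (x 1))) (Measure.pi fun _ => μ) :=
    (pencilValue_integrable_tensor μ he hk).const_mul b
  have hC : Integrable (fun x : Fin 2 → ℝ => c * (e (x 0) * e (x 1))) (Measure.pi fun _ => μ) :=
    (pencilValue_integrable_tensor μ he he).const_mul c
  have hAB : Integrable (fun x : Fin 2 → ℝ => a * (k (x 0) * k (x 1)) + b * (e (x 0) * k (x 1)))
      (Measure.pi fun _ => μ) := hA.add hB
  rw [integral_add hAB hC, integral_add hA hB, integral_const_mul, integral_const_mul,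
    integral_const_mul, pencilValue_integral_tensor, pencilValue_integral_tensor,
    pencilValue_integral_tensor]
  ring

/-- The Legendre density of the first kind `k(t) = 1/√((1−t²)(1−st²))` is integrable on
`(0,1)` for `0 ≤ s < 1` (tree lemma `M1.integrableOn_kap`, i.e. `ellIntegrand s`). [folklore] -/
theorem pencilValue_integrableOn_k {s : ℝ} (hs0 : 0 ≤ s) (hs1 : s < 1) :
    IntegrableOn (fun t : ℝ => 1 / Real.sqrt ((1 - t ^ 2) * (1 - s * t ^ 2))) (Ioo 0 1) :=
  M1.integrableOn_kap hs0 hs1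

/-- **`PencilValue`** (route ZeroPortrait, stmt-KontsevichZagierPeriods-12736): for rationals
`a, b, c` and `0 < s < 1`, an integral representation on the open unit square `(0,1)²` with
integrand `a·k(x₀)k(x₁) + b·e(x₀)k(x₁) + c·e(x₀)e(x₁)` (`k(t) = 1/√((1−t²)(1−st²))`,
`e(t) = √(1−st²)/√(1−t²)`) has value `a·K² + b·E·K + c·E²`, `K = ∫_{(0,1)} k`,
`E = ∫_{(0,1)} e`. Proof: the square is the product set `Set.pi univ (Ioo 0 1)`, the restricted
Lebesgue measure is the product of the restricted one-dimensional ones, both densities are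
integrable on `(0,1)`, and Fubini for tensor products plus linearity give the value. [folklore] -/
theorem pencilValue_proof :
    Summit.KontsevichZagierPeriods.KontsevichZagierPeriods.Theses.ZeroPortrait.PencilValue := by
  intro a b c s hs0 hs1 r hd hf
  unfold Literature.NumberTheory.Transcendental.KZ.IntegralRep.value
  have hS : ({x | ∀ i, x i ∈ Set.Ioo (0:ℝ) 1} : Set (Fin 2 → ℝ)) =
      Set.pi Set.univ (fun _ => Set.Ioo (0:ℝ) 1) := by
    ext x
    simp
  have hm : MeasurableSet r.domain := by
    rw [hd, hS]
    exact MeasurableSet.univ_pi (fun _ => measurableSet_Ioo)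
  rw [setIntegral_congr_fun hm hf, hd, hS, volume_pi, Measure.restrict_pi_pi]
  have hs0' : (0:ℝ) ≤ (s:ℝ) := by exact_mod_cast hs0.le
  have hs1' : (s:ℝ) < 1 := by exact_mod_cast hs1
  exact pencilValue_integral_pencil ((volume : Measure ℝ).restrict (Ioo 0 1))
    (pencilValue_integrableOn_k hs0' hs1') (M1.integrableOn_e hs0') a b c

end Summit.KontsevichZagierPeriods.ZeroPortrait
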